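import Summits.Schanuel.Schanuel.Theorems.RootDecomp1KSubspaceBranch04
import Mathlib.FieldTheory.IsAlgClosed.AlgebraicClosure
import Mathlib.RingTheory.Polynomial.Eisenstein.Basic
import Mathlib.NumberTheory.Height.NumberField

/-!
# RootDecomp1KHeightGrading — lens 1, generation 52, NODE 12 «THE HEIGHT GRADING: the thin-fibre clause graded by (deg_Y P, xdeg P) via the height transfer along the curve» (RULE K-R42 (P4)/(P2), K-R43) — part 1 (RootDecomp1KHeightGrading01): §0 definitions and the binder HeightComparison, §1 heights, §2 the two asymptotic inequalities

(lens-1 g52 NODE 12 HOME kernel K = HOME/decomp-schanuel-lens-1/g52/HeightGrading.lean d2c43eec…, 936 l, 89 thm + 14 def, imports tree …RootDecomp1KSubspaceBranch04 + Mathlib FieldTheory.IsAlgClosed.AlgebraicClosure, RingTheory.Polynomial.Eisenstein.Basic, NumberTheory.Height.NumberField ONLY; Probe HeightGradingProbe.lean rc 0 (116 axiom guards) / Ctrl0 rc 0 / Ctrl rc 1 = 22 planted; memo NODE-g52b.md with the DERIVATION MEMO (d1)–(d6); SHA256SUMS (25 entries); cite-kind ledger item wi-102467 (Lang 1983 Ch.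 4 Cor. 3.5, curve case → consumption shape HeightComparison); CLAIM L2556, crit EX-ANTE PRICE L2560 (ONE THEOREM ×1 under RULE K-R42 (P4) iff CHECKLIST K-g52b; binder = the ε-form ONLY, label (β) paper corollary with derivation memo; RULES K-R43, K-R42 (vii′)), NODE L2563 / REQUEST L2564, census STAGING NOTE 2 L2565, critic VERDICT L2566: CLEARED — THEOREM ×1 under RULE K-R42 (P4), CHECKLIST K-g52b met, binder grade (β) under K-R43 with derivation memo (d1)–(d6); PORT GO (credit port, verbatim; MODs = docstrings + the one privatisation); lens-1 tally ×14 + THEOREM ×11. Port by census-1 gen 22 as `RootDecomp1KHeightGrading01–03` (`--supports stmt-Schanuel-33364`; no census credit): 01 = §0 `logHt` (= Mathlib's `Height.logHeight₁` on ℚ, `logHt_eq_logHeight₁`), `GeomIrreducible P` (irreducible over `AlgebraicClosure ℚ`), the ONE new input typed by name **`HeightComparison : Prop`** ([hypothesis] definition — the ε-form of the height comparison `|xdeg P · h(x) − deg_Y P · h(y)| ≤ ε·h(x) + c` on the rational points of a geometrically irreducible plane curve; sources in the docstring: Lang 1983 Ch. 4 Cor. 3.5, Bombieri–Gubler, Hindry–Silverman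 B.5.9, Serre; a THEOREM in print, NOT proved in the tree), `BddLevelEmpty` + §1 heights of rationals and of `x_N` + §2 the two asymptotic inequalities (real arithmetic); 02 = §3 THEOREM A **`thinFibreAt_of_heightComparison (hH) (hgi : GeomIrreducible P) (hk : 1 ≤ xdeg P) (hlt : P.natDegree < m₀ * xdeg P) : ThinFibreAt m₀ P`** + §4 THEOREM B **`thinFibreAt_iff_bddLevelEmpty_of_heightComparison`** (strict side `m₀ * xdeg P < P.natDegree`; `thinFibreAt_of_bddLevelEmpty` hyp-free) + §5 residual RE-GRADED (`HeightDecidedAt`, `HeightOffAt`, `HeightOnlyOffAt`, `thinFibre_of_padicSubspace_heightComparison`, `heightOffAt_of_offSbAt`; bookkeeping ×0) + §6 (first half) the member `H17P` = x³(Y²−17)² + x²Y + x(Y+1) + Y⁵ with `geomIrreducible_H17P` (Eisenstein at (x)) and `thinFibreAt_two_H17P`; 03 = §6 (second half) the COSTUME TEST BY NAME (`not_decidedAt_two_H17P`, `not_sepTopAt_H17P`, `thinThreshold_H17P`, …) + the boundary member `B17P` = Y² − 17x and the norm-form non-member `N2P` = Y² − 2x² (`not_geomIrreducible_N2P`). PORT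 EDITS: the generic one-liner `half_lt_log_two` PRIVATISED (dry-run dedup.foreign note: prints like `Summit.Parity.….log_two_gt_half` of another summit; used only inside §2); 27 one-line docstrings added on undocumented computation lemmas / member defs (statements quoted); `xdeg` is the TREE's `RootDecomp1KDegreeLadder.xdeg` (no re-declaration); K has no private decls, no set_option, no «[cite» token; the one `example` (xdeg of an x-linear presentation) kept; statements and proofs otherwise VERBATIM. Rung 0 — nothing here proves Schanuel, 33364, 33363, 31077 or ThinFibre 2; everything is CONDITIONAL on `HeightComparison` (and §5 also on `PadicSubspace`).)
-/

/-!
# RootDecomp1KHeightGrading — lens 1, generation 52, node 12 «THE HEIGHT GRADING: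
  the thin-fibre clause graded by (deg_Y P, xdeg P) via the height transfer along the curve»
  (RULE K-R42 (P4)/(P2), K-R43; CLAIM L2556, PRICE L2560)

HONEST SCOPE (line 1).  TWO theorems on the K-line's thin-fibre residual, MODULO ONE NEW INPUT OF A DIFFERENT KIND typed by
name — the HEIGHT COMPARISON on a plane curve (Weil's height machine + Siegel's degree comparison on a curve: a theorem of
elementary height theory IN PRINT — Lang 1983 Ch. 4 Cor. 3.5 — NOT proved in the tree; typed ε-form by `HeightComparison :
Prop` below and used ONLY as a hypothesis `(hH : HeightComparison)`).  NO DECISION BEYOND LANG: every Diophantine decision in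
this file is Lang's corollary; what the file adds is the bookkeeping that turns it into the K-line's clause (depth of the
residual lowered, rung count 0, no ∀-item moves: 33364 / 33363 / 31077 / `Schanuel` UNMOVED; `ThinFibre 2` NOT proved).

* THEOREM A `thinFibreAt_of_heightComparison (hH : HeightComparison) (hgi : GeomIrreducible P) (hk : 1 ≤ xdeg P)
  (hlt : P.natDegree < m₀ * xdeg P) : ThinFibreAt m₀ P` — the tree's free regime «`deg_Y P < m₀`» (Gauss, exponent `1/n`,
  hypothesis-free) UPGRADED, modulo the binder, to «`deg_Y P < m₀ · xdeg P`» (height transfer, exponent `k/n`), for EVERY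
  `m₀`, every top `x`-coefficient (separable or not, any `ℚ₂`-multiplicity), every order and every branch at `(∞, ∞)`.
  HONESTY: at `xdeg P = 1` THEOREM A is WEAKER than the tree (`thinFibreAt_of_natDegree_lt` gives the same class with NO
  hypothesis), and on the x-lacunary / two-term members the tree's hypothesis-free ladders (`thinFibreAt_xPolyP_gap`,
  `thinFibreAt_twoTermP`) remain the theorems of record; A is new only for `xdeg P ≥ 2` off those shapes (member §6).
* THEOREM B `thinFibreAt_iff_bddLevelEmpty_of_heightComparison (hH) (hgi) (hk) (hm : 1 ≤ m₀)
  (hlt : m₀ * xdeg P < P.natDegree) : ThinFibreAt m₀ P ↔ BddLevelEmpty P` (STRICT; `BddLevelEmpty P ↔ LevelFinite P`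
  hypothesis-free, `bddLevelEmpty_iff_levelFinite`) — for `deg_Y P > m₀ · xdeg P` the clause `den(r)^{m₀N} > C·2^{(N+1)!}`
  FAILS at every rational point of every large bounded level, so there the thin-fibre clause IS eventual emptiness of the
  bounded fibres (what every emptiness proof of the K-line was for, typed once); `←` is hypothesis-free
  (`thinFibreAt_of_bddLevelEmpty`).  The BOUNDARY `deg_Y P = m₀ · xdeg P` is decided by NEITHER theorem (it would need the
  `O(√h)` comparison of Néron / Bombieri–Gubler 9.3.10, which is NOT a binder of this node — one binder, K-R41): OPEN here,
  member `B17P = Y² − 17x` of §6.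

THE INPUT (ε-form, the ONLY binder).  `HeightComparison` = for every geometrically irreducible `P ∈ ℤ[x][Y]` with
`k = xdeg P ≥ 1`, `n = deg_Y P ≥ 1` and every `ε > 0` there is `c` with `|k·h(x) − n·h(y)| ≤ ε·h(x) + c` at every RATIONAL
point `(x, y)` of `P = 0`, `h = logHt` the absolute logarithmic Weil height on `ℚ ⊂ ℙ¹` (`h(0) = 0`, `logHt_zero`).
(Sources: Lang, Fundamentals of Diophantine Geometry (1983) Ch. 4 Cor. 3.5 «V complete non-singular, deg X = d, deg Y = d′
⇒ h_X quasi-equivalent to (d/d′)·h_Y; the case of curves is due to Siegel», with the additive quasi-equivalence of Ch. 4 §3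
and the height machine of Ch. 4 §1–2, on the normalisation of the curve with `X = x*[∞]` (degree `n`), `Y = y*[∞]` (degree
`k`); derivation print ⇒ binder = steps (d1)–(d6) of HOME g52/NODE-g52b.md; also Hindry–Silverman (2000) Thm B.5.9, Serre,
Mordell–Weil lectures §2.8.  The `O(√h)` form, Bombieri–Gubler (2006) Cor. 9.3.10, is NOT used.)  WEAKER-OR-EQUAL than print:
rational affine points of one plane model only.  NOT the K-line's antecedent of record `Lang1983_integralValues_planeCurve_
parametric` (Siegel's theorem on integral points), NOT `PadicSubspace` / Ridout (local approximation, node 11): a GLOBAL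
transfer of height along the curve — a third print antecedent of a different kind.

WHY IT BITES (the mechanism in one line).  `h(x_N) = N!·log 2 + O(1)` exactly (`den x_N = 2^{N!}`, tree `coprime_psNumer`;
§1), so a rational point `(x_N, r)` has `log den r` between `((k − ε)·N!·log 2 − c)/n − log max(C, 1)` and
`((k + ε)·(N!·log 2 + log 2) + c)/n`, while the clause asks `log den r > ((N+1)!/(m₀N))·log 2 + (log C)/(m₀N)
= (N!/m₀)(1 + 1/N)·log 2 + o(1)`: with `ε = 1/(2m₀)` this is decided by the sign of `k/n − 1/m₀` — `n < m₀k` ⇒ the clause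
holds (A), `n > m₀k` ⇒ it fails (B) (§2, real arithmetic only).

§0 definitions (`logHt`, `GeomIrreducible`, the binder `HeightComparison`; `BddLevelEmpty`) · §1 heights of rationals and
of `x_N` (`xQ`, `xQ_den`, `le_logHt_xQ`, `logHt_xQ_le`) · §2 the two asymptotic inequalities (`clause_of_lower_height`,
`not_clause_of_upper_height`) · §3 THEOREM A · §4 THEOREM B + the grading `thinFibreAt_grading` · §5 the residual of record
RE-GRADED (bookkeeping ×0, said so): `ThinFibre m₀ ⟸ PadicSubspace ∧ HeightComparison ∧ HeightOffAt m₀` with the weakening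
`SiegelShapesOffSbAt m₀ → HeightOffAt m₀` PROVED, and Subspace-free `ThinFibre m₀ ⟸ HeightComparison ∧ HeightOnlyOffAt m₀`
· §6 the member `H17P = x³(Y²−17)² + x²Y + x(Y+1) + Y⁵` at `m₀ = 2` (`n = 5 < 6 = 2·3`, top `(Y²−17)²` NOT separable,
`μ_ℚ₂ = 2`, `e = 1`, `thinThreshold = 5`, no `x`-gap, not two-term): `GeomIrreducible H17P` PROVED (Eisenstein at the prime
`(x)` of `ℚ̄[x]`), `ThinFibreAt 2 H17P` mod `HeightComparison`, the COSTUME TEST BY NAME `¬ DecidedAt 2 H17P ∧ ¬ SepTopAt 2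
H17P` (outside every tree class at `m₀ = 2` and outside node 11); the boundary member `B17P = Y² − 17x` (`2 = 2·1`) and the
norm form `N2P = Y² − 2x²` (degrees inside the class, `¬ GeomIrreducible N2P` PROVED) mark the two honest limits.
Imports: tree `…RootDecomp1KSubspaceBranch04` (node 11 port; brings XTop03/XAll05/LevelFinite11/13) + Mathlib
`FieldTheory.IsAlgClosed.AlgebraicClosure`, `RingTheory.Polynomial.Eisenstein.Basic`, `NumberTheory.Height.NumberField` ONLY.  `xdeg` is the TREE's
(`RootDecomp1KDegreeLadder.xdeg`, reused by name); `logHt` IS Mathlib's canonical `Height.logHeight₁` on `ℚ` (PROVED equal,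
`logHt_eq_logHeight₁`, via `Rat.logHeight₁_eq_log_max`) kept as an elementary abbreviation; `GeomIrreducible`, `BddLevelEmpty`,
`HeightComparison` are new and namespaced here (census dedup pre-scan L2562).
-/

noncomputable section

namespace Summit.Schanuel.Schanuel.Theorems.RootDecomp1KHeightGrading

open Polynomial LiouvilleNumber
open scoped Nat
open Summit.Schanuel.Schanuel.Theorems.RootDecomp1KSkelCell (SkelLiouvilleFix)
open Summit.Schanuel.Schanuel.Theorems.RootDecomp1KTwoBaseCell (psNumer partialSum_eq_psNumer_div coprime_psNumer
  partialSum_pos' partialSum_lt_two)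
open Summit.Schanuel.Schanuel.Theorems.RootDecomp1KDegreeLadder
open Summit.Schanuel.Schanuel.Theorems.RootDecomp1KXLinearCore
open Summit.Schanuel.Schanuel.Theorems.RootDecomp1KXLinear
open Summit.Schanuel.Schanuel.Theorems.RootDecomp1KXLinearII
open Summit.Schanuel.Schanuel.Theorems.RootDecomp1KXTop
open Summit.Schanuel.Schanuel.Theorems.RootDecomp1KXAll
open Summit.Schanuel.Schanuel.Theorems.RootDecomp1KLevelFinite
open Summit.Schanuel.Schanuel.Theorems.RootDecomp1KSubspaceBranch

/-! ### §0  Definitions: the height on `ℚ`, geometric irreducibility, the binder -/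

/-- the absolute logarithmic Weil height on `ℚ ⊂ ℙ¹(ℚ)`: `h(a/b) = log max(|a|, b)` in lowest terms (`b ≥ 1`). -/
def logHt (q : ℚ) : ℝ := Real.log (max |(q.num : ℝ)| (q.den : ℝ))

/-- [class] definition (census convention): **geometric irreducibility** of the plane curve `P(x, y) = 0` —
`P` is irreducible in `ℚ̄[x][Y]` (`ℚ̄ = AlgebraicClosure ℚ`). -/
def GeomIrreducible (P : ℤ[X][X]) : Prop :=
  Irreducible (P.map (mapRingHom (algebraMap ℤ (AlgebraicClosure ℚ))))

/-- [hypothesis] definition (a THEOREM in print, NOT proved in the tree; used below only as an explicit hypothesis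
`(hH : HeightComparison)`; binder grade (β) «paper corollary with a numbered derivation memo», RULE K-R43; the
derivation print ⇒ binder is steps (d1)–(d6) of HOME g52/NODE-g52b.md): **THE HEIGHT COMPARISON ON A PLANE CURVE**
(Weil's height machine with Siegel's degree comparison — additive quasi-equivalence, ε-form).  For every geometrically
irreducible `P ∈ ℤ[x][Y]` with `k = xdeg P ≥ 1`, `n = deg_Y P ≥ 1` and every `ε > 0` there is a constant `c` with
`|k·h(x) − n·h(y)| ≤ ε·h(x) + c` at every rational point `(x, y)` of `P = 0` (`h = logHt`, the absolute logarithmic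
Weil height on `ℚ`; `h(0) = 0`).  (Sources: Lang, Fundamentals of Diophantine Geometry (1983) Ch. 4 Cor. 3.5 «V a complete
non-singular curve, deg X = d, deg Y = d′ ⇒ h_X quasi-equivalent to (d/d′)·h_Y; the case of curves is due to Siegel»,
with the additive quasi-equivalence `(1−ε)h₁ − c₁ ≤ h₂ ≤ (1+ε)h₁ + c₂` of Ch. 4 §3 and the height machine of Ch. 4 §1–2,
applied on the normalisation `V` of the curve to `X = x*[∞]` (degree `n`) and `Y = y*[∞]` (degree `k`); the same with an
`O(√h)` error term is Bombieri–Gubler (2006) Cor. 9.3.10 (Néron), not used here.)  Special case typed: rational affine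
points of one plane model.  NOT the K-line's antecedent of record (Siegel's theorem on integral points, via the tree's
bridge), NOT `PadicSubspace` / Ridout: a GLOBAL transfer of height along the curve. -/
def HeightComparison : Prop :=
  ∀ P : ℤ[X][X], GeomIrreducible P → 1 ≤ xdeg P → 1 ≤ P.natDegree → ∀ ε : ℝ, 0 < ε →
    ∃ c : ℝ, ∀ x y : ℚ, bev P x y = 0 →
      |(xdeg P : ℝ) * logHt x - (P.natDegree : ℝ) * logHt y| ≤ ε * logHt x + c

/-- [residual class] statement def (census convention): **eventual EMPTINESS of the bounded fibres** — for every
bound `C`, beyond some level `N₀` the level curve `P(x_N, ·) = 0` has NO non-degenerate rational point `r` with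
`|r| ≤ C` (the same as the tree's `LevelFinite P`: `bddLevelEmpty_iff_levelFinite`). -/
def BddLevelEmpty (P : ℤ[X][X]) : Prop :=
  ∀ C : ℝ, ∃ N₀ : ℕ, ∀ N : ℕ, N₀ ≤ N → ∀ r : ℚ, |(r : ℝ)| ≤ C →
    bev P (partialSum 2 N) r = 0 → ¬ ∃ x : ℝ, bev P x r ≠ 0

/-- `BddLevelEmpty P ↔ LevelFinite P` (a set of levels is finite iff bounded) — hypothesis-free. -/
theorem bddLevelEmpty_iff_levelFinite (P : ℤ[X][X]) : BddLevelEmpty P ↔ LevelFinite P := by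
  constructor
  · intro h C
    obtain ⟨N₀, hN₀⟩ := h C
    refine (Set.finite_lt_nat N₀).subset fun N hN => ?_
    obtain ⟨r, hrC, hroot, hnd⟩ := hN
    show N < N₀
    by_contra hge
    push Not at hge
    exact hN₀ N hge r hrC hroot hnd
  · intro h C
    obtain ⟨N₀, hN₀⟩ := (h C).bddAbove
    refine ⟨N₀ + 1, fun N hN r hrC hroot hnd => ?_⟩
    have : N ≤ N₀ := hN₀ ⟨r, hrC, hroot, hnd⟩
    omega

/-- `BddLevelEmpty P → ThinFibreAt m₀ P` for every `m₀` (beyond the last level the clause is vacuous) — hypothesis-free. -/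
theorem thinFibreAt_of_bddLevelEmpty {P : ℤ[X][X]} (h : BddLevelEmpty P) (m₀ : ℕ) : ThinFibreAt m₀ P := by
  intro C
  obtain ⟨N₀, hN₀⟩ := h C
  exact ⟨N₀, fun N hN r hrC hroot hnd => absurd hnd (hN₀ N hN r hrC hroot)⟩

/-- `h(0) = 0` (`num 0 = 0`, `den 0 = 1`): the junk-free value at the origin. -/
theorem logHt_zero : logHt 0 = 0 := by simp [logHt]

/-- DEDUP (checklist K-g52b (9)): `logHt` IS Mathlib's canonical absolute logarithmic height `Height.logHeight₁` on the
number field `ℚ` — PROVED equal (Mathlib `Rat.logHeight₁_eq_log_max`); the elementary form is kept for the arithmetic below. -/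
theorem logHt_eq_logHeight₁ (q : ℚ) : logHt q = Height.logHeight₁ q := by
  rw [Rat.logHeight₁_eq_log_max, logHt, Nat.cast_max, Nat.cast_natAbs, Int.cast_abs]

/-- `xdeg` (tree `RootDecomp1KDegreeLadder.xdeg`: the largest `x`-degree of a `Y`-coefficient) IS the `x`-degree under the
tree's inner/outer convention: `xdeg (Σ_{j ≤ k} x^j c_j(Y)) = k` when `c_k ≠ 0` (tree `xdeg_xPolyP`), e.g. for the
x-linear presentation `A(Y) + x·B(Y) = xPolyP 1 (A, B)`. -/
example (A B : ℤ[X]) (hB : B ≠ 0) : xdeg (xPolyP 1 fun j => if j = 0 then A else B) = 1 :=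
  xdeg_xPolyP 1 _ (by simpa using hB)

/-! ### §1  Heights of rationals and of the level abscissa `x_N = p_N / 2^{N!}` -/

/-- `1 ≤ max(|num q|, den q)`. -/
theorem one_le_htMax (q : ℚ) : (1 : ℝ) ≤ max |(q.num : ℝ)| (q.den : ℝ) :=
  le_max_of_le_right (by exact_mod_cast q.den_pos)

/-- `0 < max(|num q|, den q)`. -/
theorem htMax_pos (q : ℚ) : (0 : ℝ) < max |(q.num : ℝ)| (q.den : ℝ) :=
  lt_of_lt_of_le one_pos (one_le_htMax q)

/-- `0 ≤ h(q)`. -/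
theorem logHt_nonneg (q : ℚ) : 0 ≤ logHt q := Real.log_nonneg (one_le_htMax q)

/-- `log den q ≤ h(q)`. -/
theorem log_den_le_logHt (q : ℚ) : Real.log (q.den : ℝ) ≤ logHt q :=
  Real.log_le_log (by exact_mod_cast q.den_pos) (le_max_right _ _)

/-- `|q| ≤ C ⇒ h(q) ≤ log max(C, 1) + log den q` (`|num q| = |q|·den q ≤ max(C,1)·den q`). -/
theorem logHt_le_of_abs_le {q : ℚ} {C : ℝ} (h : |(q : ℝ)| ≤ C) :
    logHt q ≤ Real.log (max C 1) + Real.log (q.den : ℝ) := by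
  have hden : (0 : ℝ) < q.den := by exact_mod_cast q.den_pos
  have hC1 : (1 : ℝ) ≤ max C 1 := le_max_right _ _
  have hnum : |(q.num : ℝ)| = |(q : ℝ)| * q.den := by
    have hq : (q : ℝ) = (q.num : ℝ) / (q.den : ℝ) := by exact_mod_cast (Rat.num_div_den q).symm
    rw [hq, abs_div, abs_of_pos hden, div_mul_cancel₀ _ hden.ne']
  have hmax : max |(q.num : ℝ)| (q.den : ℝ) ≤ max C 1 * q.den := by
    refine max_le ?_ ?_
    · rw [hnum]; exact mul_le_mul_of_nonneg_right (h.trans (le_max_left _ _)) hden.le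
    · exact le_mul_of_one_le_left hden.le hC1
  unfold logHt
  rw [← Real.log_mul (by positivity) hden.ne']
  exact Real.log_le_log (htMax_pos q) hmax

/-- the level abscissa as a rational number: `xQ N = p_N / 2^{N!}`. -/
def xQ (N : ℕ) : ℚ := (psNumer 2 N : ℚ) / (2 : ℚ) ^ N !

/-- `(xQ N : ℝ) = partialSum 2 N = x_N`. -/
theorem xQ_cast (N : ℕ) : ((xQ N : ℚ) : ℝ) = partialSum 2 N := by
  have h := partialSum_eq_psNumer_div (b := 2) two_pos N
  push_cast at h
  rw [h, xQ]; push_cast; rfl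

/-- `den (xQ N) = 2^{N!}` for `N ≥ 2` (`p_N` is odd: tree `coprime_psNumer`). -/
theorem xQ_den {N : ℕ} (hN : 2 ≤ N) : ((xQ N).den : ℤ) = 2 ^ N ! := by
  have hcop : Nat.Coprime (psNumer 2 N) (2 ^ N !) := (coprime_psNumer 2 hN).pow_right _
  have h := Rat.den_div_eq_of_coprime (a := (psNumer 2 N : ℤ)) (b := (2 : ℤ) ^ N !) (by positivity)
    (by rw [Int.natAbs_natCast, Int.natAbs_pow]; exact hcop)
  have e : ((psNumer 2 N : ℤ) : ℚ) / (((2 : ℤ) ^ N ! : ℤ) : ℚ) = xQ N := by rw [xQ]; push_cast; rfl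
  rw [e] at h
  exact h

/-- `N!·log 2 ≤ h(x_N)` (`N ≥ 2`). -/
theorem le_logHt_xQ {N : ℕ} (hN : 2 ≤ N) : (N ! : ℝ) * Real.log 2 ≤ logHt (xQ N) := by
  refine le_trans ?_ (log_den_le_logHt (xQ N))
  have h : ((xQ N).den : ℝ) = 2 ^ N ! := by exact_mod_cast xQ_den hN
  rw [h, Real.log_pow]

/-- `h(x_N) ≤ N!·log 2 + log 2` (`N ≥ 2`; `x_N < 2`). -/
theorem logHt_xQ_le {N : ℕ} (hN : 2 ≤ N) : logHt (xQ N) ≤ (N ! : ℝ) * Real.log 2 + Real.log 2 := by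
  have habs : |((xQ N : ℚ) : ℝ)| ≤ 2 := by
    rw [xQ_cast, abs_of_pos (partialSum_pos' two_pos N)]
    exact (partialSum_lt_two le_rfl N).le
  have h := logHt_le_of_abs_le habs
  have hden : ((xQ N).den : ℝ) = 2 ^ N ! := by exact_mod_cast xQ_den hN
  rw [hden, Real.log_pow, show max (2 : ℝ) 1 = 2 by norm_num] at h
  linarith

/-! ### §2  The two asymptotic inequalities (real arithmetic; no Diophantine input) -/

/-- `1/2 < log 2`. -/
private theorem half_lt_log_two : (1 : ℝ) / 2 < Real.log 2 := by
  have := Real.log_two_gt_d9; linarith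

/-- for every bound `B` eventually `B ≤ N!·log 2`. -/
theorem eventually_le_factorial_log (B : ℝ) : ∃ N₀ : ℕ, ∀ N : ℕ, N₀ ≤ N → B ≤ (N ! : ℝ) * Real.log 2 := by
  obtain ⟨M, hM⟩ := exists_nat_ge (2 * B)
  refine ⟨M, fun N hN => ?_⟩
  have h1 : (M : ℝ) ≤ N := by exact_mod_cast hN
  have h2 : (N : ℝ) ≤ N ! := by exact_mod_cast Nat.self_le_factorial N
  have h3 := half_lt_log_two
  have h4 : (0 : ℝ) ≤ N ! := by positivity
  nlinarith

/-- **the inequality behind THEOREM A** (`ε = 1/(2m₀)`): `n < m₀·k` and the lower height bound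
`(k − 1/(2m₀))·L − c ≤ n·(log max(C,1) + log d)` (`L = N!·log 2`) force the clause `C·2^{(N+1)!} < d^{m₀N}` for
`N ≥ N₀(n, k, m₀, c, C)`. -/
theorem clause_of_lower_height {n k m₀ : ℕ} (hn : 1 ≤ n) (hlt : n < m₀ * k) (c C : ℝ) :
    ∃ N₀ : ℕ, ∀ N : ℕ, N₀ ≤ N → ∀ d : ℕ, 1 ≤ d →
      ((k : ℝ) - 1 / (2 * m₀)) * ((N ! : ℝ) * Real.log 2) - c ≤ (n : ℝ) * (Real.log (max C 1) + Real.log (d : ℝ)) →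
      C * 2 ^ (N + 1)! < (d : ℝ) ^ (m₀ * N) := by
  set LC : ℝ := Real.log (max C 1) with hLC
  have hLC0 : 0 ≤ LC := Real.log_nonneg (le_max_right _ _)
  obtain ⟨N₁, hN₁⟩ := eventually_le_factorial_log (4 * (m₀ : ℝ) * |c| + 4 * n * (m₀ + 1) * LC + 1)
  refine ⟨max N₁ (max 2 (4 * n)), fun N hN d hd hineq => ?_⟩
  have hNN₁ : N₁ ≤ N := le_trans (le_max_left _ _) hN
  have hN4n : 4 * n ≤ N := le_trans (le_trans (le_max_right _ _) (le_max_right _ _)) hN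
  set L : ℝ := (N ! : ℝ) * Real.log 2 with hLdef
  have hB : 4 * (m₀ : ℝ) * |c| + 4 * n * (m₀ + 1) * LC + 1 ≤ L := hN₁ N hNN₁
  have hL0 : 0 ≤ L := by positivity
  have hm1 : 1 ≤ m₀ := by
    rcases Nat.eq_zero_or_pos m₀ with h0 | h0
    · subst h0; simp at hlt
    · exact h0
  have hm0 : (0 : ℝ) < m₀ := by exact_mod_cast hm1
  have hd0 : (0 : ℝ) < d := by exact_mod_cast hd
  have hlogd : 0 ≤ Real.log (d : ℝ) := Real.log_nonneg (by exact_mod_cast hd)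
  have hn0 : (0 : ℝ) < n := by exact_mod_cast hn
  have hmk : (n : ℝ) + 1 ≤ (m₀ : ℝ) * k := by exact_mod_cast hlt
  have hNr : 4 * (n : ℝ) ≤ N := by exact_mod_cast hN4n
  have hN1 : (1 : ℝ) ≤ N := by exact_mod_cast (show 1 ≤ N by omega)
  by_cases hC : C ≤ 0
  · exact lt_of_le_of_lt (mul_nonpos_of_nonpos_of_nonneg hC (by positivity)) (by positivity)
  push Not at hC
  have hlogC : Real.log C ≤ LC := Real.log_le_log hC (le_max_left _ _)
  rw [← Real.log_lt_log_iff (by positivity) (by positivity), Real.log_mul hC.ne' (by positivity), Real.log_pow,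
    Real.log_pow]
  push_cast
  have hfact : (((N + 1)! : ℕ) : ℝ) = ((N : ℝ) + 1) * (N ! : ℝ) := by
    rw [Nat.factorial_succ]; push_cast; ring
  rw [hfact]
  -- m₀ · ((k − 1/(2m₀)) L) = (m₀ k − 1/2) L ≥ (n + 1/2) L
  have hhalf : (m₀ : ℝ) * (1 / (2 * (m₀ : ℝ))) = 1 / 2 := by
    rw [mul_one_div, div_eq_iff (by positivity)]; ring
  have e0 : (m₀ : ℝ) * (((k : ℝ) - 1 / (2 * m₀)) * L) = ((m₀ : ℝ) * k - 1 / 2) * L := by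
    linear_combination (-L) * hhalf
  have h1 : (m₀ : ℝ) * ((n : ℝ) * (LC + Real.log d)) ≥ ((n : ℝ) + 1 / 2) * L - (m₀ : ℝ) * c := by
    have := mul_le_mul_of_nonneg_left hineq hm0.le
    rw [mul_sub, e0] at this
    nlinarith
  -- multiply by N
  have h2 : (N : ℝ) * ((m₀ : ℝ) * ((n : ℝ) * (LC + Real.log d))) ≥
      (N : ℝ) * (((n : ℝ) + 1 / 2) * L - (m₀ : ℝ) * c) := mul_le_mul_of_nonneg_left h1 (by positivity)
  have h3 : (N : ℝ) * LC ≥ Real.log C := by nlinarith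
  have h4 : (N : ℝ) * L ≥ 4 * n * L := by nlinarith
  have h5 : (m₀ : ℝ) * c ≤ (m₀ : ℝ) * |c| := mul_le_mul_of_nonneg_left (le_abs_self c) hm0.le
  -- target: n * (log C + ((N+1) N! log 2)) < n * (m₀ N log d)
  have hmain : (n : ℝ) * (Real.log C + ((N : ℝ) + 1) * (N ! : ℝ) * Real.log 2) <
      (n : ℝ) * ((m₀ : ℝ) * N * Real.log d) := by
    have e1 : ((N : ℝ) + 1) * (N ! : ℝ) * Real.log 2 = N * L + L := by rw [hLdef]; ring
    rw [e1]
    have e2 : (n : ℝ) * ((m₀ : ℝ) * N * Real.log d) =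
        (N : ℝ) * ((m₀ : ℝ) * ((n : ℝ) * (LC + Real.log d))) - (m₀ : ℝ) * N * (n * LC) := by ring
    rw [e2]
    nlinarith [mul_nonneg (by positivity : (0:ℝ) ≤ (N : ℝ)) hLC0, mul_nonneg hm0.le (abs_nonneg c),
      mul_nonneg (mul_nonneg hm0.le hn0.le) hLC0]
  have := lt_of_mul_lt_mul_left hmain hn0.le
  linarith

/-- **the inequality behind THEOREM B** (`ε = 1/(2m₀)`): `m₀·k < n` and the upper height bound
`n·log d ≤ (k + 1/(2m₀))·(L + log 2) + c` force the FAILURE of the clause `C·2^{(N+1)!} < d^{m₀N}` for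
`N ≥ N₀(n, k, m₀, c)` (`C ≥ 1`). -/
theorem not_clause_of_upper_height {n k m₀ : ℕ} (hm : 1 ≤ m₀) (hlt : m₀ * k < n) (c : ℝ) {C : ℝ} (hC : 1 ≤ C) :
    ∃ N₀ : ℕ, ∀ N : ℕ, N₀ ≤ N → ∀ d : ℕ, 1 ≤ d →
      (n : ℝ) * Real.log (d : ℝ) ≤ ((k : ℝ) + 1 / (2 * m₀)) * ((N ! : ℝ) * Real.log 2 + Real.log 2) + c →
      ¬ (C * 2 ^ (N + 1)! < (d : ℝ) ^ (m₀ * N)) := by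
  obtain ⟨N₁, hN₁⟩ := eventually_le_factorial_log (2 * (n : ℝ) * Real.log 2 + 2 * n * (m₀ : ℝ) * |c| + 1)
  refine ⟨max N₁ 1, fun N hN d hd hineq hcl => ?_⟩
  have hNN₁ : N₁ ≤ N := le_trans (le_max_left _ _) hN
  set L : ℝ := (N ! : ℝ) * Real.log 2 with hLdef
  have hB : 2 * (n : ℝ) * Real.log 2 + 2 * n * (m₀ : ℝ) * |c| + 1 ≤ L := hN₁ N hNN₁
  have hl2pos : 0 < Real.log 2 := Real.log_pos one_lt_two
  have hL0 : 0 ≤ L := by positivity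
  have hm0 : (0 : ℝ) < m₀ := by exact_mod_cast hm
  have hd0 : (0 : ℝ) < d := by exact_mod_cast hd
  have hC0 : 0 < C := by linarith
  have hcl' := hcl
  rw [← Real.log_lt_log_iff (by positivity) (by positivity), Real.log_mul hC0.ne' (by positivity), Real.log_pow,
    Real.log_pow] at hcl'
  push_cast at hcl'
  have hfact : (((N + 1)! : ℕ) : ℝ) = ((N : ℝ) + 1) * (N ! : ℝ) := by
    rw [Nat.factorial_succ]; push_cast; ring
  rw [hfact] at hcl'
  have hlogC : 0 ≤ Real.log C := Real.log_nonneg hC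
  have hn1 : (m₀ : ℝ) * k + 1 ≤ n := by exact_mod_cast hlt
  have hn0 : (0 : ℝ) < n := by have : (0:ℝ) ≤ (m₀ : ℝ) * k := by positivity
                               linarith
  have hlogd : 0 ≤ Real.log (d : ℝ) := Real.log_nonneg (by exact_mod_cast hd)
  have hN0 : (0 : ℝ) ≤ N := by positivity
  -- m₀ (k + 1/(2m₀)) = m₀ k + 1/2 ≤ n − 1/2
  have hhalf : (m₀ : ℝ) * (1 / (2 * (m₀ : ℝ))) = 1 / 2 := by
    rw [mul_one_div, div_eq_iff (by positivity)]; ring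
  have e0 : (m₀ : ℝ) * (((k : ℝ) + 1 / (2 * m₀)) * (L + Real.log 2)) = ((m₀ : ℝ) * k + 1 / 2) * (L + Real.log 2) := by
    linear_combination (L + Real.log 2) * hhalf
  have h1 : (m₀ : ℝ) * ((n : ℝ) * Real.log d) ≤ ((n : ℝ) - 1 / 2) * (L + Real.log 2) + (m₀ : ℝ) * |c| := by
    have := mul_le_mul_of_nonneg_left hineq hm0.le
    rw [mul_add, e0] at this
    have hc : (m₀ : ℝ) * c ≤ (m₀ : ℝ) * |c| := mul_le_mul_of_nonneg_left (le_abs_self c) hm0.le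
    have hLl : 0 ≤ L + Real.log 2 := by positivity
    nlinarith
  have h2 : (N : ℝ) * ((m₀ : ℝ) * ((n : ℝ) * Real.log d)) ≤
      (N : ℝ) * (((n : ℝ) - 1 / 2) * (L + Real.log 2) + (m₀ : ℝ) * |c|) := mul_le_mul_of_nonneg_left h1 hN0
  -- from the clause (times n): n log C + n (N L + L) < n m₀ N log d = N · (m₀ (n log d))
  have hlow : (n : ℝ) * (Real.log C + ((N : ℝ) + 1) * (N ! : ℝ) * Real.log 2) <
      (n : ℝ) * ((m₀ : ℝ) * N * Real.log d) := mul_lt_mul_of_pos_left hcl' hn0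
  have e1 : ((N : ℝ) + 1) * (N ! : ℝ) * Real.log 2 = N * L + L := by rw [hLdef]; ring
  have e2 : (n : ℝ) * ((m₀ : ℝ) * N * Real.log d) = (N : ℝ) * ((m₀ : ℝ) * ((n : ℝ) * Real.log d)) := by ring
  rw [e1, e2] at hlow
  -- so n N L + n L ≤ … < N (n − 1/2)(L + log 2) + N m₀ |c| = n N L − N L/2 + N (n − 1/2) log 2 + N m₀ |c|
  -- i.e. n L + N L / 2 < N (n − 1/2) log 2 + N m₀ |c| ≤ N (n log 2 + m₀ |c|) ≤ N · L / 2 — contradiction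
  have hn1' : (1 : ℝ) ≤ n := by linarith [show (0:ℝ) ≤ (m₀ : ℝ) * k by positivity]
  have hmc : (m₀ : ℝ) * |c| ≤ (n : ℝ) * ((m₀ : ℝ) * |c|) := le_mul_of_one_le_left (by positivity) hn1'
  have h3 : (N : ℝ) * ((n : ℝ) * Real.log 2 + (m₀ : ℝ) * |c|) ≤ (N : ℝ) * (L / 2) :=
    mul_le_mul_of_nonneg_left (by linarith) hN0
  have h4 : 0 ≤ (n : ℝ) * Real.log C := by positivity
  nlinarith [mul_nonneg hN0 hl2pos.le, mul_nonneg hn0.le hL0]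

end Summit.Schanuel.Schanuel.Theorems.RootDecomp1KHeightGrading

end
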